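import Literature.Analysis.FunctionSpaces.WeakLp
import Literature.Analysis.FunctionSpaces.LorentzDyadic
import Literature.Analysis.FunctionSpaces.DyadicShellSummation
import Literature.Analysis.FunctionSpaces.LittlewoodPaleyBernsteinProofs
import Literature.Analysis.FluidPDE.NSCriticalClosureBesovProofs
import Literature.Analysis.FluidPDE.CriticalSpacesProofs
import Literature.Analysis.FluidPDE.CriticalRegularityProofs
import Literature.Analysis.FluidPDE.LittlewoodPaleyBlockFn
import HarnessLib

/-!
# The endpoint embedding `L^{3,∞}(ℝ³) ⊂ Ḃ^{-1+3/r}_{r,∞}(ℝ³)`, `3 < r < ∞` (weak `L³` into Besov)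

Analysis/FluidPDE file (PROVED theorem), companion of `LorentzBesovEmbedding.lean` (the case
`q < ∞`).  Weak-`L³` (Marcinkiewicz, `L^{3,∞}`) data embed into the critical negative Besov spaces
with third index `∞`:

  `‖f‖_{Ḃ^{-1+3/r}_{r,∞}} ≤ C ‖f‖_{L^{3,∞}}`,  `3 < r < ∞`

(the weak-`L³` strengthening of the chain `L³ ⊂ Ḃ^{-1/2,∞}_6 ⊂ Ḃ^{-1,∞}_∞` "provided by
Bernstein's inequalities" printed in Y. Meyer's C.I.M.E. lectures, LNM 1871 (2006), §2 (2.21); the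
`L^{3,∞}` data class of Barker–Seregin, arXiv:1603.03211, and of the tree's weak-`L³` files).  In the tree's vocabulary (`weakL3_subset_homBesov`): for every
a.e.-strongly measurable `f : ℝ³ → ℝ^ι` with `eWeakLpPow f 3 < ∞` (`= sup_t t³ |{|f| > t}|`,
`WeakLp.lean`) there is a tempered distribution `U` with `IsDistributionOf f U` and
`eHomBesovNorm (-1+3/r) r ∞ U ≤ C · (eWeakLpPow f 3)^{1/3}`, `C = C(r) < ∞`.

Proof: as in `LorentzBesovEmbedding.lean` — dyadic layers per block, distributional Bernstein
`L¹ → L^r` on the high layers, the uniform block bound on the low layers — with the supremum form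
of the shell-summation lemma (`FunctionSpaces.iSup_tsum_dyadicBump_le`) and the weak-`L³` control
`2^k |{2^k < |f|}|^{1/3} ≤ (eWeakLpPow f 3)^{1/3}` of the dyadic sequence.  Consumers: the weak-`L³`
rows of the census `pub/ns-census` (F7, A2e, F5c vocabulary `FunctionSpaces.eWeakLpPow`).

## References

* Y. Meyer, *Oscillating patterns in some nonlinear evolution equations*, in: Mathematical
  Foundation of Turbulent Viscous Flows (C.I.M.E. 2003), LNM 1871, Springer 2006, 101–187, §2 (2.21)
  (`L³ ⊂ Ḃ^{-1/2,∞}_6 ⊂ Ḃ^{-1,∞}_∞` by Bernstein) and §7 (Navier–Stokes in `L^{(3,∞)}`).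
  [Meyer2006OscillatingPatterns]
* T. Barker, G. Seregin, *On global solutions to the Navier–Stokes system with large `L^{3,∞}`
  initial data*, arXiv:1603.03211, §1. [BarkerSeregin2016]
* H. Bahouri, J.-Y. Chemin, R. Danchin, *Fourier Analysis and Nonlinear PDE*, Springer 2011,
  Lemma 2.1 (Bernstein), Def. 2.15. [BahouriCheminDanchin2011]
* L. Grafakos, *Classical Fourier Analysis*, 3rd ed., Def. 1.1.5 (weak `L^p`). [Grafakos2014]
-/

noncomputable section

open MeasureTheory Set Function Filter SchwartzMap
open Literature.Analysis.FunctionSpaces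
open scoped ENNReal NNReal Topology

namespace Literature.Analysis.FluidPDE

section Helpers

/-- Sub-additivity of `x ↦ x^s`, `0 < s ≤ 1`, over a series in `[0, ∞]` (copy of the private helper
of `LorentzBesovEmbedding.lean`). [folklore] -/
private theorem rpow_tsum_le_tsum_rpow' {κ : Type*} (x : κ → ℝ≥0∞) {s : ℝ} (hs0 : 0 < s)
    (hs1 : s ≤ 1) : (∑' k, x k) ^ s ≤ ∑' k, (x k) ^ s := by
  classical
  set t : ℝ := 1 / s with ht
  have ht1 : 1 ≤ t := by rw [ht, le_div_iff₀ hs0]; linarith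
  have ht0 : 0 < t := by linarith
  have hxy : ∀ k, x k = ((x k) ^ s) ^ t := fun k => by
    rw [← ENNReal.rpow_mul, ht, mul_one_div_cancel hs0.ne', ENNReal.rpow_one]
  have hsuper : ∑' k, ((x k) ^ s) ^ t ≤ (∑' k, (x k) ^ s) ^ t := by
    rw [ENNReal.tsum_eq_iSup_sum]
    refine iSup_le fun F => ?_
    calc ∑ k ∈ F, ((x k) ^ s) ^ t ≤ (∑ k ∈ F, (x k) ^ s) ^ t := by
          induction F using Finset.induction_on with
          | empty => simp
          | insert a F ha ih =>
            rw [Finset.sum_insert ha, Finset.sum_insert ha]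
            exact (add_le_add le_rfl ih).trans (ENNReal.add_rpow_le_rpow_add _ _ ht1)
      _ ≤ (∑' k, (x k) ^ s) ^ t := ENNReal.rpow_le_rpow (ENNReal.sum_le_tsum F) ht0.le
  calc (∑' k, x k) ^ s = (∑' k, ((x k) ^ s) ^ t) ^ s := by
        congr 1; exact tsum_congr hxy
    _ ≤ ((∑' k, (x k) ^ s) ^ t) ^ s := ENNReal.rpow_le_rpow hsuper hs0.le
    _ = ∑' k, (x k) ^ s := by
        rw [← ENNReal.rpow_mul, ht, one_div_mul_cancel hs0.ne', ENNReal.rpow_one]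

variable {α : Type*} [MeasurableSpace α] {μ : Measure α} {V : Type*} [NormedAddCommGroup V]

/-- The union of a family of dyadic layers of an a.e.-strongly measurable field is null-measurable
(copy of the private helper of `LorentzBesovEmbedding.lean`). [folklore] -/
private theorem nullMeasurableSet_layers' {f : α → V} (hf : AEStronglyMeasurable f μ) (H : Set ℤ) :
    NullMeasurableSet {x | ∃ k ∈ H, (2 : ℝ) ^ k < ‖f x‖ ∧ ‖f x‖ ≤ (2 : ℝ) ^ (k + 1)} μ := by
  have hset : {x | ∃ k ∈ H, (2 : ℝ) ^ k < ‖f x‖ ∧ ‖f x‖ ≤ (2 : ℝ) ^ (k + 1)} =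
      ⋃ k : ℤ, ⋃ (_ : k ∈ H), ({x | (2 : ℝ) ^ k < ‖f x‖} ∩ {x | ‖f x‖ ≤ (2 : ℝ) ^ (k + 1)}) := by
    ext x
    simp only [mem_setOf_eq, mem_iUnion, mem_inter_iff, exists_prop]
  rw [hset]
  refine NullMeasurableSet.iUnion fun k => NullMeasurableSet.iUnion fun _ => ?_
  exact (nullMeasurableSet_lt aemeasurable_const hf.norm.aemeasurable).inter
    (nullMeasurableSet_le hf.norm.aemeasurable aemeasurable_const)

omit [MeasurableSpace α] in
/-- The dyadic superlevel sets in the two spellings (`ℝ`-valued norm vs. `ℝ≥0∞`-valued norm with an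
`ℝ≥0` level). [folklore] -/
private theorem setOf_two_zpow_lt_norm_eq {f : α → V} (k : ℤ) :
    {x | (2 : ℝ) ^ k < ‖f x‖} = {x | (((2 : ℝ≥0) ^ k : ℝ≥0) : ℝ≥0∞) < ‖f x‖ₑ} := by
  ext x
  simp only [mem_setOf_eq, enorm_eq_nnnorm, ENNReal.coe_lt_coe, ← NNReal.coe_lt_coe,
    NNReal.coe_zpow, NNReal.coe_ofNat, coe_nnnorm]

/-- `ℝ≥0∞` algebra of the high layers: `2^{2j} · (2^{k+1} c³) = 2 · (2^k c) · (2^j c)²`. [folklore] -/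
private theorem two_rpow_high_layer (j k : ℤ) (c : ℝ≥0∞) :
    (2 : ℝ≥0∞) ^ (2 * (j : ℝ)) * ((2 : ℝ≥0∞) ^ ((k : ℝ) + 1) * c ^ (3 : ℝ)) =
      2 * (((2 : ℝ≥0∞) ^ (k : ℝ) * c) * ((2 : ℝ≥0∞) ^ (j : ℝ) * c) ^ (2 : ℝ)) := by
  rw [ENNReal.mul_rpow_of_nonneg _ _ (by norm_num : (0 : ℝ) ≤ 2), ← ENNReal.rpow_mul]
  have h3 : c ^ (3 : ℝ) = c * c ^ (2 : ℝ) := by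
    rw [show (3 : ℝ) = 1 + 2 by norm_num, ENNReal.rpow_add_of_nonneg _ _ zero_le_one zero_le_two,
      ENNReal.rpow_one]
  have h21 : (2 : ℝ≥0∞) ^ ((k : ℝ) + 1) = (2 : ℝ≥0∞) ^ (k : ℝ) * 2 := by
    rw [ENNReal.rpow_add _ _ two_ne_zero ENNReal.ofNat_ne_top, ENNReal.rpow_one]
  rw [h3, h21]
  have h22 : (2 : ℝ≥0∞) ^ (2 * (j : ℝ)) = (2 : ℝ≥0∞) ^ ((j : ℝ) * 2) := by ring_nf
  rw [h22]
  ring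

/-- `ℝ≥0∞` algebra of the low layers: for `c ≠ 0, ∞` and `s = -1 + 3/r'`,
`2^{js} · (2^{k+1} (c³)^{1/r'}) = 2 · (2^k c) · (2^j c)^s`. [folklore] -/
private theorem two_rpow_low_layer (j k : ℤ) {c : ℝ≥0∞} (hc0 : c ≠ 0) (hct : c ≠ ⊤) (r' : ℝ) :
    (2 : ℝ≥0∞) ^ ((j : ℝ) * (-1 + 3 / r')) *
        ((2 : ℝ≥0∞) ^ ((k : ℝ) + 1) * (c ^ (3 : ℝ)) ^ (1 / r')) =
      2 * (((2 : ℝ≥0∞) ^ (k : ℝ) * c) * ((2 : ℝ≥0∞) ^ (j : ℝ) * c) ^ (-1 + 3 / r')) := by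
  have h2j0 : (2 : ℝ≥0∞) ^ (j : ℝ) ≠ 0 := ne_of_gt (ENNReal.rpow_pos two_pos ENNReal.ofNat_ne_top)
  rw [ENNReal.mul_rpow_of_ne_zero h2j0 hc0, ← ENNReal.rpow_mul, ← ENNReal.rpow_mul]
  have hc : c ^ (3 * (1 / r')) = c * c ^ (-1 + 3 / r') := by
    rw [show 3 * (1 / r') = 1 + (-1 + 3 / r') by ring, ENNReal.rpow_add _ _ hc0 hct,
      ENNReal.rpow_one]
  have h21 : (2 : ℝ≥0∞) ^ ((k : ℝ) + 1) = (2 : ℝ≥0∞) ^ (k : ℝ) * 2 := by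
    rw [ENNReal.rpow_add _ _ two_ne_zero ENNReal.ofNat_ne_top, ENNReal.rpow_one]
  rw [hc, h21]
  ring

/-- Indicators commute with positive powers in `[0, ∞]`. [folklore] -/
private theorem indicator_rpow_of_pos {κ : Type*} (S : Set κ) (g : κ → ℝ≥0∞) {p : ℝ} (hp : 0 < p)
    (k : κ) : (S.indicator g k) ^ p = S.indicator (fun k => (g k) ^ p) k := by
  classical
  by_cases hk : k ∈ S
  · rw [indicator_of_mem hk, indicator_of_mem hk]
  · rw [indicator_of_notMem hk, indicator_of_notMem hk, ENNReal.zero_rpow_of_pos hp]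

end Helpers

section Main

variable {ι : Type*} [Fintype ι]

/-- **`L^{3,∞}(ℝ³) ⊂ Ḃ^{-1+3/r}_{r,∞}(ℝ³)`** (`3 < r < ∞`; weak `L³` into the critical Besov
scale, third index `∞`).  For every a.e.-strongly measurable `f : ℝ³ → ℝ^ι` with
`eWeakLpPow f 3 < ∞` there is a tempered distribution `U` representing `f` (`IsDistributionOf f U`)
with `‖U‖_{Ḃ^{-1+3/r}_{r,∞}} ≤ C · (eWeakLpPow f 3)^{1/3}` (`= C ‖f‖_{L^{3,∞}}`), the constant
`C < ∞` depending only on `r` (and `ι`).  Proof: dyadic layers + Bernstein, supremum form of the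
shell summation; see the module docstring.
(The printed source states the `L³` case, (2.21), "provided by Bernstein's inequalities"; the weak-`L³`
statement proved here is its standard strengthening by the same inequalities.)
[cite: Meyer2006OscillatingPatterns, §2 (2.21) (L³ ⊂ Ḃ^{-1/2,∞}_6 ⊂ Ḃ^{-1,∞}_∞ by Bernstein) and §7 (L^{(3,∞)})] -/
theorem weakL3_subset_homBesov (r : ℝ≥0∞) [Fact (1 ≤ r)] (h3r : 3 < r) (hrtop : r < ⊤) :
    ∃ C : ℝ≥0∞, C < ⊤ ∧ ∀ f : EuclideanSpace ℝ (Fin 3) → EuclideanSpace ℝ ι,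
      AEStronglyMeasurable f volume → eWeakLpPow f 3 volume < ⊤ →
        ∃ U : 𝓢'(EuclideanSpace ℝ (Fin 3), EuclideanSpace ℂ ι), IsDistributionOf f U ∧
          eHomBesovNorm (-1 + 3 / r.toReal) r ⊤ U ≤
            C * eWeakLpPow f 3 volume ^ (1 / (3 : ℝ)) := by
  classical
  -- exponents
  have hr3 : (3 : ℝ) < r.toReal := by
    have h := (ENNReal.toReal_lt_toReal (by norm_num) hrtop.ne).2 h3r
    simpa using h
  have hr0 : 0 < r.toReal := by linarith
  set r' : ℝ := r.toReal with hr'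
  set s : ℝ := -1 + 3 / r' with hs
  have hβ : 0 < 1 - 3 / r' := by
    rw [sub_pos, div_lt_one hr0]; exact hr3
  have hs' : s = -(1 - 3 / r') := by rw [hs]; ring
  haveI h11 : Fact (1 ≤ (1 : ℝ≥0∞)) := ⟨le_rfl⟩
  -- constants
  obtain ⟨CB, -, hCB⟩ := exists_eLpNormDistrib_lpBlock_le (E := EuclideanSpace ℝ (Fin 3))
    (F := EuclideanSpace ℂ ι) 1 r (Fact.out)
  obtain ⟨C1, hC1⟩ := exists_eLpNormDistrib_lpBlock_le_eLpNormDistrib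
    (E := EuclideanSpace ℝ (Fin 3)) (F := EuclideanSpace ℂ ι) 1
  obtain ⟨Cr, hCr⟩ := exists_eLpNormDistrib_lpBlock_le_eLpNormDistrib
    (E := EuclideanSpace ℝ (Fin 3)) (F := EuclideanSpace ℂ ι) r
  obtain ⟨CS, hCStop, hCS⟩ := iSup_tsum_dyadicBump_le (α := 2) (β := 1 - 3 / r') two_pos hβ
  set K : ℝ≥0∞ := 2 * ((CB : ℝ≥0∞) * C1 + Cr) with hK
  have hKtop : K < ⊤ := by
    rw [hK]
    exact ENNReal.mul_lt_top ENNReal.ofNat_lt_top (ENNReal.add_lt_top.2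
      ⟨ENNReal.mul_lt_top ENNReal.coe_lt_top ENNReal.coe_lt_top, ENNReal.coe_lt_top⟩)
  clear_value K
  refine ⟨K * CS, ENNReal.mul_lt_top hKtop hCStop, fun f hf hW => ?_⟩
  -- the dyadic data of `f`
  set d : ℤ → ℝ≥0∞ := fun k => volume {x | (2 : ℝ) ^ k < ‖f x‖} with hd
  set c : ℤ → ℝ≥0∞ := fun k => (d k) ^ (1 / (3 : ℝ)) with hc
  set a : ℤ → ℝ≥0∞ := fun k => (2 : ℝ≥0∞) ^ (k : ℝ) * c k with ha
  set φ : ℤ → ℤ → ℝ≥0∞ := fun j k =>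
    if (2 : ℝ≥0∞) ^ (j : ℝ) * c k ≤ 1 then ((2 : ℝ≥0∞) ^ (j : ℝ) * c k) ^ (2 : ℝ)
      else ((2 : ℝ≥0∞) ^ (j : ℝ) * c k) ^ (-(1 - 3 / r')) with hφ
  set S : ℤ → ℝ≥0∞ := fun j => ∑' k, a k * φ j k with hS
  have hcd : ∀ k, (c k) ^ (3 : ℝ) = d k := fun k => by
    simp only [hc]
    rw [← ENNReal.rpow_mul, one_div_mul_cancel (by norm_num : (3 : ℝ) ≠ 0), ENNReal.rpow_one]
  -- weak-`L³` control of the dyadic sequence: `(a k)^3 = 2^{3k} d k ≤ W`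
  have ha3' : ∀ k : ℤ, ((2 : ℝ≥0∞) ^ (k : ℝ)) ^ (3 : ℝ) * d k ≤ eWeakLpPow f 3 volume := by
    intro k
    have h := rpow_mul_meas_lt_le_eWeakLpPow f 3 volume ((2 : ℝ≥0) ^ k)
    rw [← setOf_two_zpow_lt_norm_eq, ENNReal.toReal_ofNat] at h
    have h2 : (((2 : ℝ≥0) ^ k : ℝ≥0) : ℝ≥0∞) = (2 : ℝ≥0∞) ^ (k : ℝ) := by
      rw [ENNReal.coe_zpow two_ne_zero, ← ENNReal.rpow_intCast]
      norm_num
    rw [h2] at h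
    exact h
  have ha3 : ∀ k : ℤ, (a k) ^ (3 : ℝ) ≤ eWeakLpPow f 3 volume := by
    intro k
    calc (a k) ^ (3 : ℝ) = ((2 : ℝ≥0∞) ^ (k : ℝ)) ^ (3 : ℝ) * (c k) ^ (3 : ℝ) := by
          simp only [ha]; rw [ENNReal.mul_rpow_of_nonneg _ _ (by norm_num)]
      _ = ((2 : ℝ≥0∞) ^ (k : ℝ)) ^ (3 : ℝ) * d k := by rw [hcd k]
      _ ≤ eWeakLpPow f 3 volume := ha3' k
  have ha_le : ∀ k : ℤ, a k ≤ eWeakLpPow f 3 volume ^ (1 / (3 : ℝ)) := by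
    intro k
    calc a k = ((a k) ^ (3 : ℝ)) ^ (1 / (3 : ℝ)) := by
          rw [← ENNReal.rpow_mul, mul_one_div_cancel (by norm_num : (3 : ℝ) ≠ 0), ENNReal.rpow_one]
      _ ≤ eWeakLpPow f 3 volume ^ (1 / (3 : ℝ)) := ENNReal.rpow_le_rpow (ha3 k) (by norm_num)
  have hd_top : ∀ k : ℤ, d k < ⊤ := by
    intro k
    have h1 : ((2 : ℝ≥0∞) ^ (k : ℝ)) ^ (3 : ℝ) * d k < ⊤ := lt_of_le_of_lt (ha3' k) hW
    have hne : ((2 : ℝ≥0∞) ^ (k : ℝ)) ^ (3 : ℝ) ≠ 0 :=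
      ne_of_gt (ENNReal.rpow_pos (ENNReal.rpow_pos two_pos ENNReal.ofNat_ne_top)
        (ENNReal.rpow_ne_top_of_ne_zero two_ne_zero ENNReal.ofNat_ne_top))
    by_contra hc'
    rw [not_lt, top_le_iff] at hc'
    rw [hc', ENNReal.mul_top hne] at h1
    exact lt_irrefl _ h1
  have hc_top : ∀ k, c k ≠ ⊤ := fun k =>
    ENNReal.rpow_ne_top_of_nonneg (by norm_num) (hd_top k).ne
  have h2ne : ∀ y : ℝ, (2 : ℝ≥0∞) ^ y ≠ 0 := fun y =>
    ne_of_gt (ENNReal.rpow_pos two_pos ENNReal.ofNat_ne_top)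
  have h2nt : ∀ y : ℝ, (2 : ℝ≥0∞) ^ y ≠ ⊤ := fun y =>
    ENNReal.rpow_ne_top_of_ne_zero two_ne_zero ENNReal.ofNat_ne_top
  -- shell summation (supremum form)
  have hSsup : (⨆ j, S j) ≤ CS * ⨆ k, a k := hCS c
  have hasup : (⨆ k, a k) ≤ eWeakLpPow f 3 volume ^ (1 / (3 : ℝ)) := iSup_le ha_le
  have hStop : ∀ j : ℤ, S j < ⊤ := by
    intro j
    have h1 : S j ≤ ⨆ j, S j := le_iSup S j
    exact lt_of_le_of_lt (h1.trans (hSsup.trans (mul_le_mul' le_rfl hasup)))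
      (ENNReal.mul_lt_top hCStop (ENNReal.rpow_lt_top_of_nonneg (by norm_num) hW.ne))
  -- the layered splitting, block by block: `H j` = high layers (the `L¹` piece)
  set H : ℤ → Set ℤ := fun j => {k : ℤ | (2 : ℝ≥0∞) ^ (j : ℝ) * c k ≤ 1} with hH
  set X : ℤ → Set (EuclideanSpace ℝ (Fin 3)) := fun j =>
    {x | ∃ k ∈ H j, (2 : ℝ) ^ k < ‖f x‖ ∧ ‖f x‖ ≤ (2 : ℝ) ^ (k + 1)} with hX
  set h : ℤ → EuclideanSpace ℝ (Fin 3) → EuclideanSpace ℝ ι := fun j => (X j).indicator f with hh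
  set ℓ : ℤ → EuclideanSpace ℝ (Fin 3) → EuclideanSpace ℝ ι := fun j => f - h j with hℓ
  set I1 : ℤ → ℝ≥0∞ := fun j =>
    ∑' k, (H j).indicator (fun k => (2 : ℝ≥0∞) ^ ((k : ℝ) + 1) * d k) k with hI1def
  set I2 : ℤ → ℝ≥0∞ := fun j =>
    ∑' k, (H j)ᶜ.indicator (fun k => (2 : ℝ≥0∞) ^ (((k : ℝ) + 1) * r') * d k) k with hI2def
  -- (i) sizes of the pieces (dyadic layer bounds)
  have hI1 : ∀ j : ℤ, ∫⁻ x, ‖h j x‖ₑ ≤ I1 j := fun j => lintegral_enorm_layers_le_tsum hf (H j)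
  have hI2 : ∀ j : ℤ, ∫⁻ x, ‖ℓ j x‖ₑ ^ r' ≤ I2 j := by
    intro j
    calc ∫⁻ x, ‖ℓ j x‖ₑ ^ r'
        ≤ ∫⁻ x, ‖{x | ∃ k ∈ (H j)ᶜ, (2 : ℝ) ^ k < ‖f x‖ ∧ ‖f x‖ ≤ (2 : ℝ) ^ (k + 1)}.indicator
            f x‖ₑ ^ r' := by
          refine lintegral_mono fun x => ENNReal.rpow_le_rpow ?_ hr0.le
          rw [← ofReal_norm, ← ofReal_norm]
          exact ENNReal.ofReal_le_ofReal (norm_sub_indicator_layers_le f (H j) x)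
      _ ≤ I2 j := lintegral_enorm_rpow_layers_le_tsum hf (H j)ᶜ hr0
  -- (ii) the sizes against the bump sums: `2^{2j} I1 j ≤ 2 S j`, `2^{js} (I2 j)^{1/r'} ≤ 2 S j`
  have hI1S : ∀ j : ℤ, (2 : ℝ≥0∞) ^ (2 * (j : ℝ)) * I1 j ≤ 2 * S j := by
    intro j
    simp only [hI1def, hS]
    rw [← ENNReal.tsum_mul_left, ← ENNReal.tsum_mul_left]
    refine ENNReal.tsum_le_tsum fun k => ?_
    by_cases hk : k ∈ H j
    · have hk' : (2 : ℝ≥0∞) ^ (j : ℝ) * c k ≤ 1 := hk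
      rw [indicator_of_mem hk, ← hcd k, two_rpow_high_layer]
      have hφk : φ j k = ((2 : ℝ≥0∞) ^ (j : ℝ) * c k) ^ (2 : ℝ) := by
        simp only [hφ]
        rw [if_pos hk']
      rw [hφk]
    · rw [indicator_of_notMem hk, mul_zero]
      exact bot_le
  have hI2S : ∀ j : ℤ, (2 : ℝ≥0∞) ^ ((j : ℝ) * s) * (I2 j) ^ (1 / r') ≤ 2 * S j := by
    intro j
    have hr1' : 1 / r' ≤ 1 := by rw [div_le_one hr0]; linarith
    have hsub : (I2 j) ^ (1 / r') ≤
        ∑' k, (H j)ᶜ.indicator (fun k => (2 : ℝ≥0∞) ^ ((k : ℝ) + 1) * (d k) ^ (1 / r')) k := by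
      refine (rpow_tsum_le_tsum_rpow' _ (by positivity) hr1').trans (le_of_eq (tsum_congr fun k => ?_))
      rw [indicator_rpow_of_pos _ _ (by positivity)]
      by_cases hk : k ∈ (H j)ᶜ
      · rw [indicator_of_mem hk, indicator_of_mem hk, ENNReal.mul_rpow_of_nonneg _ _ (by positivity),
          ← ENNReal.rpow_mul, show ((k : ℝ) + 1) * r' * (1 / r') = (k : ℝ) + 1 by field_simp]
      · rw [indicator_of_notMem hk, indicator_of_notMem hk]
    calc (2 : ℝ≥0∞) ^ ((j : ℝ) * s) * (I2 j) ^ (1 / r')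
        ≤ (2 : ℝ≥0∞) ^ ((j : ℝ) * s) *
            ∑' k, (H j)ᶜ.indicator (fun k => (2 : ℝ≥0∞) ^ ((k : ℝ) + 1) * (d k) ^ (1 / r')) k :=
          mul_le_mul' le_rfl hsub
      _ = ∑' k, (2 : ℝ≥0∞) ^ ((j : ℝ) * s) *
            (H j)ᶜ.indicator (fun k => (2 : ℝ≥0∞) ^ ((k : ℝ) + 1) * (d k) ^ (1 / r')) k :=
          ENNReal.tsum_mul_left.symm
      _ ≤ ∑' k, 2 * (a k * φ j k) := by
          refine ENNReal.tsum_le_tsum fun k => ?_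
          by_cases hk : k ∈ (H j)ᶜ
          · have hk' : ¬ ((2 : ℝ≥0∞) ^ (j : ℝ) * c k ≤ 1) := hk
            have hc0 : c k ≠ 0 := by
              intro h0
              apply hk'
              rw [h0, mul_zero]
              exact zero_le_one
            rw [indicator_of_mem hk, ← hcd k, hs, two_rpow_low_layer j k hc0 (hc_top k) r']
            have hφk : φ j k = ((2 : ℝ≥0∞) ^ (j : ℝ) * c k) ^ (-(1 - 3 / r')) := by
              simp only [hφ]
              rw [if_neg hk']
            rw [hφk, show -(1 - 3 / r') = -1 + 3 / r' by ring]
          · rw [indicator_of_notMem hk, mul_zero]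
            exact bot_le
      _ = 2 * S j := by rw [ENNReal.tsum_mul_left]
  -- (iii) integrability of the pieces
  have hXnull : ∀ j : ℤ, NullMeasurableSet (X j) volume := fun j => nullMeasurableSet_layers' hf (H j)
  have hh_meas : ∀ j : ℤ, AEStronglyMeasurable (h j) volume := fun j => hf.indicator₀ (hXnull j)
  have hℓ_meas : ∀ j : ℤ, AEStronglyMeasurable (ℓ j) volume := fun j => hf.sub (hh_meas j)
  have hI1top : ∀ j : ℤ, I1 j < ⊤ := by
    intro j
    have hle : I1 j ≤ ((2 : ℝ≥0∞) ^ (2 * (j : ℝ)))⁻¹ * (2 * S j) := by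
      calc I1 j = ((2 : ℝ≥0∞) ^ (2 * (j : ℝ)))⁻¹ * ((2 : ℝ≥0∞) ^ (2 * (j : ℝ)) * I1 j) := by
            rw [← mul_assoc, ENNReal.inv_mul_cancel (h2ne _) (h2nt _), one_mul]
        _ ≤ ((2 : ℝ≥0∞) ^ (2 * (j : ℝ)))⁻¹ * (2 * S j) := mul_le_mul' le_rfl (hI1S j)
    exact lt_of_le_of_lt hle (ENNReal.mul_lt_top (ENNReal.inv_lt_top.2
      (ENNReal.rpow_pos two_pos ENNReal.ofNat_ne_top)) (ENNReal.mul_lt_top ENNReal.ofNat_lt_top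
      (hStop j)))
  have hI2top : ∀ j : ℤ, I2 j < ⊤ := by
    intro j
    have hle : (I2 j) ^ (1 / r') ≤ ((2 : ℝ≥0∞) ^ ((j : ℝ) * s))⁻¹ * (2 * S j) := by
      calc (I2 j) ^ (1 / r')
          = ((2 : ℝ≥0∞) ^ ((j : ℝ) * s))⁻¹ * ((2 : ℝ≥0∞) ^ ((j : ℝ) * s) * (I2 j) ^ (1 / r')) := by
            rw [← mul_assoc, ENNReal.inv_mul_cancel (h2ne _) (h2nt _), one_mul]
        _ ≤ ((2 : ℝ≥0∞) ^ ((j : ℝ) * s))⁻¹ * (2 * S j) := mul_le_mul' le_rfl (hI2S j)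
    have hlt : (I2 j) ^ (1 / r') < ⊤ :=
      lt_of_le_of_lt hle (ENNReal.mul_lt_top (ENNReal.inv_lt_top.2
        (ENNReal.rpow_pos two_pos ENNReal.ofNat_ne_top)) (ENNReal.mul_lt_top ENNReal.ofNat_lt_top
        (hStop j)))
    exact (ENNReal.rpow_lt_top_iff_of_pos (by positivity)).1 hlt
  have hr_ne0 : r ≠ 0 := ne_of_gt (lt_trans (by norm_num) h3r)
  have hh_mem : ∀ j : ℤ, MemLp (h j) 1 volume := fun j =>
    ⟨hh_meas j, by rw [eLpNorm_one_eq_lintegral_enorm]; exact lt_of_le_of_lt (hI1 j) (hI1top j)⟩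
  have hℓ_mem : ∀ j : ℤ, MemLp (ℓ j) r volume := fun j =>
    ⟨hℓ_meas j, by
      rw [eLpNorm_eq_lintegral_rpow_enorm_toReal hr_ne0 hrtop.ne]
      exact ENNReal.rpow_lt_top_of_nonneg (by positivity)
        (lt_of_le_of_lt (hI2 j) (hI2top j)).ne⟩
  -- (iv) the distributions of the pieces and of `f`
  set Th : ℤ → 𝓢'(EuclideanSpace ℝ (Fin 3), EuclideanSpace ℂ ι) := fun j =>
    Lp.toTemperedDistribution ((memLp_complexify_comp (hh_mem j)).toLp _) with hTh
  set Tl : ℤ → 𝓢'(EuclideanSpace ℝ (Fin 3), EuclideanSpace ℂ ι) := fun j =>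
    Lp.toTemperedDistribution ((memLp_complexify_comp (hℓ_mem j)).toLp _) with hTl
  have hTh_dist : ∀ j : ℤ, IsDistributionOf (h j) (Th j) := fun j =>
    isDistributionOf_toTemperedDistribution (hh_mem j)
  have hTl_dist : ∀ j : ℤ, IsDistributionOf (ℓ j) (Tl j) := fun j =>
    isDistributionOf_toTemperedDistribution (hℓ_mem j)
  have hU_dist : ∀ j : ℤ, IsDistributionOf f (Th j + Tl j) := by
    intro j
    have hadd := (hTh_dist j).add (hTl_dist j)
    have hsum : h j + ℓ j = f := indicator_layers_add_sub f (H j)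
    rwa [hsum] at hadd
  set U : 𝓢'(EuclideanSpace ℝ (Fin 3), EuclideanSpace ℂ ι) := Th 0 + Tl 0 with hU
  have hUj : ∀ j : ℤ, Th j + Tl j = U := fun j => (hU_dist j).unique (hU_dist 0)
  refine ⟨U, hU_dist 0, ?_⟩
  -- (v) the block estimate `2^{js} ‖Δ̇_j U‖_{L^r} ≤ K S_j`
  have hfin3 : (Module.finrank ℝ (EuclideanSpace ℝ (Fin 3)) : ℝ) = 3 := by
    rw [finrank_euclideanSpace, Fintype.card_fin]; norm_num
  have hexp : ∀ j : ℤ, (2 : ℝ≥0∞) ^ ((j : ℝ) * s) *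
      (2 : ℝ≥0∞) ^ ((j : ℝ) * (Module.finrank ℝ (EuclideanSpace ℝ (Fin 3)) : ℝ) *
        ((1 : ℝ≥0∞).toReal⁻¹ - r.toReal⁻¹)) = (2 : ℝ≥0∞) ^ (2 * (j : ℝ)) := by
    intro j
    have hreal : (j : ℝ) * s + (j : ℝ) * (3 : ℝ) * (1 - r'⁻¹) = 2 * (j : ℝ) := by
      rw [hs]
      field_simp
      ring
    rw [hfin3, ENNReal.toReal_one, inv_one, ← ENNReal.rpow_add _ _ two_ne_zero ENNReal.ofNat_ne_top,
      hreal]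
  have hblock : ∀ j : ℤ, lpBlockWeight s r U j ≤ K * S j := by
    intro j
    rw [lpBlockWeight, ← hUj j, map_add]
    calc (2 : ℝ≥0∞) ^ ((j : ℝ) * s) * eLpNormDistrib r (lpBlock j (Th j) + lpBlock j (Tl j))
        ≤ (2 : ℝ≥0∞) ^ ((j : ℝ) * s) *
            (eLpNormDistrib r (lpBlock j (Th j)) + eLpNormDistrib r (lpBlock j (Tl j))) :=
          mul_le_mul' le_rfl (eLpNormDistrib_add_le _ _)
      _ ≤ (2 : ℝ≥0∞) ^ ((j : ℝ) * s) *
            ((CB : ℝ≥0∞) * (2 : ℝ≥0∞) ^ ((j : ℝ) *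
                (Module.finrank ℝ (EuclideanSpace ℝ (Fin 3)) : ℝ) *
                  ((1 : ℝ≥0∞).toReal⁻¹ - r.toReal⁻¹)) * ((C1 : ℝ≥0∞) * I1 j) +
              (Cr : ℝ≥0∞) * (I2 j) ^ (1 / r')) := by
          refine mul_le_mul' le_rfl (add_le_add ?_ ?_)
          · calc eLpNormDistrib r (lpBlock j (Th j))
                ≤ (CB : ℝ≥0∞) * (2 : ℝ≥0∞) ^ ((j : ℝ) *
                    (Module.finrank ℝ (EuclideanSpace ℝ (Fin 3)) : ℝ) *
                      ((1 : ℝ≥0∞).toReal⁻¹ - r.toReal⁻¹)) * eLpNormDistrib 1 (lpBlock j (Th j)) :=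
                  hCB j (Th j)
              _ ≤ (CB : ℝ≥0∞) * (2 : ℝ≥0∞) ^ ((j : ℝ) *
                    (Module.finrank ℝ (EuclideanSpace ℝ (Fin 3)) : ℝ) *
                      ((1 : ℝ≥0∞).toReal⁻¹ - r.toReal⁻¹)) * ((C1 : ℝ≥0∞) * eLpNormDistrib 1 (Th j)) :=
                  mul_le_mul' le_rfl (hC1 j (Th j))
              _ ≤ _ := by
                  rw [(hTh_dist j).eLpNormDistrib_eq (hh_mem j), eLpNorm_one_eq_lintegral_enorm]
                  exact mul_le_mul' le_rfl (mul_le_mul' le_rfl (hI1 j))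
          · calc eLpNormDistrib r (lpBlock j (Tl j)) ≤ (Cr : ℝ≥0∞) * eLpNormDistrib r (Tl j) :=
                  hCr j (Tl j)
              _ ≤ _ := by
                  rw [(hTl_dist j).eLpNormDistrib_eq (hℓ_mem j),
                    eLpNorm_eq_lintegral_rpow_enorm_toReal hr_ne0 hrtop.ne]
                  exact mul_le_mul' le_rfl (ENNReal.rpow_le_rpow (hI2 j) (by positivity))
      _ = (CB : ℝ≥0∞) * C1 * ((2 : ℝ≥0∞) ^ (2 * (j : ℝ)) * I1 j) +
            Cr * ((2 : ℝ≥0∞) ^ ((j : ℝ) * s) * (I2 j) ^ (1 / r')) := by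
          rw [← hexp j]
          ring
      _ ≤ (CB : ℝ≥0∞) * C1 * (2 * S j) + Cr * (2 * S j) :=
          add_le_add (mul_le_mul' le_rfl (hI1S j)) (mul_le_mul' le_rfl (hI2S j))
      _ = K * S j := by rw [hK]; ring
  -- (vi) the Besov norm (`q = ∞`: a supremum over the blocks)
  rw [eHomBesovNorm_top]
  calc (⨆ j : ℤ, (2 : ℝ≥0∞) ^ ((j : ℝ) * s) * eLpNormDistrib r (lpBlock j U))
      ≤ ⨆ j : ℤ, K * S j := iSup_mono fun j => hblock j
    _ = K * ⨆ j, S j := (ENNReal.mul_iSup K S).symm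
    _ ≤ K * (CS * eWeakLpPow f 3 volume ^ (1 / (3 : ℝ))) :=
        mul_le_mul' le_rfl (hSsup.trans (mul_le_mul' le_rfl hasup))
    _ = K * CS * eWeakLpPow f 3 volume ^ (1 / (3 : ℝ)) := by rw [mul_assoc]

end Main

end Literature.Analysis.FluidPDE

end
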